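import Mathlib
import Literature.Analysis.FluidPDE.IsometryInvariance
import Summits.NavierStokesRegularity.NavierStokesRegularity.Theorems.PlaneEnergyCeilingPlanarEnergyAPrioriSlabLawSinkParts

/-!
# Route PlaneEnergyCeiling · crux `PlanarEnergyAPriori` — the mild slab law WITH THE SINK

Helper file for the crux item stmt-NavierStokesRegularity-16855 (`PlanarEnergyAPriori`, route
`PlaneEnergyCeiling`), landed `--supports` that item, toward its single open piece
`stub_fluxConvergenceBudget`. The landed mild slab law `stub_slabLawMild` DROPS the dissipation;
every attack on the budget has to pay the flux convergence with exactly that sink (crux informal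
statement: "control −∂_cF at the maximising plane against ν∂²_cE and the sink 2νD"). This file
keeps it — the CALORIC DISSIPATION through the plane `{x₂ = c₀}`,

  `S(t;c₀) = 2ν ∫₀ᵗ ∫ G_{ν(t−s)}(x₂ − c₀) Σⱼ‖∂ⱼu(s,x)‖² dx ds`,

and proves, along a classical solution on `[0,t]` with order-(3,2) decay,

  `E(t;c₀) + S(t;c₀) ≤ sup_{c'} E(0;c') + 2∫₀ᵗ (√(πν(t−s)))⁻¹ · osc_{a,b}‖F(s,a) − F(s,b)‖ₑ ds`

in `ℝ≥0∞` (`slabLawSink_coord`; every direction `R`: `slabLawSink_dir`, sink weight `G_{ν(t−s)}(⟪x,Re₂⟫ − c)`). Ingredients (`Theorems/…SlabLawSinkParts.lean`): the slice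
identity, the continuity of the caloric dissipation in time, the time-integrability of the
slice-density integral; here: an abstract `ℝ≥0∞` assembly, the landed time side, the monotone limit
`s ↑ t` along `t − t/(n+2)`, and rotation covariance; registered form `slabLawMildWithSink` = the
landed `stub_slabLawMild` with the sink added on the left.
Folklore (CKN 1982 §2 with a caloric weight; Evans *PDE* §2.3).
-/

noncomputable section

-- single-conjunct summit: `Summit.<Summit>.<Problem>` repeats the name by the D-0017 layout
set_option linter.dupNamespace false

namespace Summit.NavierStokesRegularity.NavierStokesRegularity.Theorems.PlanarEnergyAPriori

open MeasureTheory Set Filter Topology Function WithLp Real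
open scoped ENNReal RealInnerProductSpace Laplacian
open Literature.Analysis.FluidPDE Literature.Analysis.UnboundedOperators
open Summit.NavierStokesRegularity.NavierStokesRegularity.Theorems.PlaneEnergyCeilingSlabEnergyIdentity
open Summit.NavierStokesRegularity.NavierStokesRegularity.Theorems.PlanarEnergyAPriori.SlabLaw

/-! ### Abstract assembly: energy + sink from a signed time-integrated identity -/

/-- **Abstract assembly in `ℝ≥0∞`**: `∫_{(0,s₁)} I = Φ₁ − Φ₀` (`I` integrable), `D ≥ 0` integrable,
`Φ₁, κ ≥ 0`, `ofReal (I + κD) ≤ B` on `(0,s₁)` ⟹ `ofReal Φ₁ + ofReal κ·∫⁻ ofReal D ≤ ofReal Φ₀ + ∫⁻ B`. -/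
theorem ofReal_add_sink_le_of_integral_eq {I D : ℝ → ℝ} {B : ℝ → ℝ≥0∞} {Φ₁ Φ₀ κ s₁ : ℝ}
    (htime : ∫ s in Ioo 0 s₁, I s = Φ₁ - Φ₀) (hI : IntegrableOn I (Ioo 0 s₁)) (hD : IntegrableOn D (Ioo 0 s₁))
    (hDnn : ∀ s ∈ Ioo 0 s₁, 0 ≤ D s) (hΦ₁ : 0 ≤ Φ₁) (hκ : 0 ≤ κ)
    (hJ : ∀ s ∈ Ioo 0 s₁, ENNReal.ofReal (I s + κ * D s) ≤ B s) :
    ENNReal.ofReal Φ₁ + ENNReal.ofReal κ * ∫⁻ s in Ioo 0 s₁, ENNReal.ofReal (D s) ≤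
      ENNReal.ofReal Φ₀ + ∫⁻ s in Ioo 0 s₁, B s := by
  have hDint_nn : 0 ≤ ∫ s in Ioo 0 s₁, D s := setIntegral_nonneg measurableSet_Ioo hDnn
  have hsum : ∫ s in Ioo 0 s₁, (I s + κ * D s) = (Φ₁ - Φ₀) + κ * ∫ s in Ioo 0 s₁, D s := by
    rw [integral_add hI (hD.const_mul κ), integral_const_mul, htime]
  have hDae : 0 ≤ᵐ[volume.restrict (Ioo 0 s₁)] D :=
    (ae_restrict_iff' measurableSet_Ioo).2 (ae_of_all _ hDnn)
  calc ENNReal.ofReal Φ₁ + ENNReal.ofReal κ * ∫⁻ s in Ioo 0 s₁, ENNReal.ofReal (D s)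
      = ENNReal.ofReal (Φ₀ + ∫ s in Ioo 0 s₁, (I s + κ * D s)) := by
        rw [← ofReal_integral_eq_lintegral_ofReal hD hDae, ← ENNReal.ofReal_mul hκ,
          ← ENNReal.ofReal_add hΦ₁ (mul_nonneg hκ hDint_nn), hsum]
        ring_nf
    _ ≤ ENNReal.ofReal Φ₀ + ENNReal.ofReal (∫ s in Ioo 0 s₁, (I s + κ * D s)) := ENNReal.ofReal_add_le
    _ ≤ ENNReal.ofReal Φ₀ + ∫⁻ s in Ioo 0 s₁, ENNReal.ofReal (I s + κ * D s) := by
        gcongr; exact Literature.MathematicalPhysics.KineticTheory.ofReal_integral_le_lintegral _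
    _ ≤ ENNReal.ofReal Φ₀ + ∫⁻ s in Ioo 0 s₁, B s := by
        gcongr 1
        exact setLIntegral_mono' measurableSet_Ioo hJ

/-! ### The mild slab law with the sink, coordinate planes -/

section Coord

variable {ν t : ℝ} {u : ℝ → EuclideanSpace ℝ (Fin 3) → EuclideanSpace ℝ (Fin 3)} {p : ℝ → EuclideanSpace ℝ (Fin 3) → ℝ}

/-- **The mild slab law with the sink, before the limit.** Classical solution on `[0,t]`,
order-(3,2) decay with pressure constant `π₀(s)`, `ν > 0`; for `0 < s₁ < t` and every `c₀`:
`ofReal(∫ G_{ν(t−s₁)}(x₂−c₀)|u(s₁)|²) + ofReal(2ν)·∫⁻_{(0,s₁)} ofReal(∫ G_{ν(t−s)}(x₂−c₀)Σⱼ‖∂ⱼu(s)‖²)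
 ≤ sup_{c'} E(0,c') + 2∫⁻_{(0,t)} ofReal((√(πν(t−s)))⁻¹)·osc F(s) ds`. [folklore] -/
theorem slabLawSink_coord_of_lt (hν : 0 < ν) (ht : 0 < t) (hcl : IsClassicalNSSolutionOn (Icc 0 t) ν 0 u p)
    {C : ℝ} {π₀ : ℝ → ℝ}
    (h0 : ∀ s ∈ Icc 0 t, ∀ x, ‖u s x‖ ≤ C * (1 + ‖x‖) ^ (-(3 : ℝ)))
    (h1 : ∀ s ∈ Icc 0 t, ∀ x, ‖fderiv ℝ (u s) x‖ ≤ C * (1 + ‖x‖) ^ (-(3 : ℝ)))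
    (h2 : ∀ s ∈ Icc 0 t, ∀ x, ‖iteratedFDeriv ℝ 2 (u s) x‖ ≤ C * (1 + ‖x‖) ^ (-(3 : ℝ)))
    (k0 : ∀ s ∈ Icc 0 t, ∀ x, |p s x - π₀ s| ≤ C * (1 + ‖x‖) ^ (-(2 : ℝ)))
    (k1 : ∀ s ∈ Icc 0 t, ∀ x, ‖gradient (p s) x‖ ≤ C * (1 + ‖x‖) ^ (-(2 : ℝ)))
    (c₀ : ℝ) {s₁ : ℝ} (hs₁ : 0 < s₁) (hs₁t : s₁ < t) :
    ENNReal.ofReal (∫ x, heatKernel (ν * (t - s₁)) (x 2 - c₀) * ‖u s₁ x‖ ^ 2) +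
      ENNReal.ofReal (2 * ν) * ∫⁻ s in Ioo 0 s₁, ENNReal.ofReal (∫ x, heatKernel (ν * (t - s)) (x 2 - c₀) *
        ∑ j : Fin 3, ‖fderiv ℝ (u s) x (EuclideanSpace.single j 1)‖ ^ 2) ≤
      (⨆ c' : ℝ, ∫⁻ y : EuclideanSpace ℝ (Fin 2), ‖u 0 (toLp 2 ![y 0, y 1, c'])‖ₑ ^ 2) +
        2 * ∫⁻ s in Ioo 0 t, ENNReal.ofReal ((Real.sqrt (π * ν * (t - s)))⁻¹) *
          ⨆ (a : ℝ) (b : ℝ), ‖(∫ y : EuclideanSpace ℝ (Fin 2), (‖u s (toLp 2 ![y 0, y 1, a])‖ ^ 2 / 2 +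
                p s (toLp 2 ![y 0, y 1, a])) * u s (toLp 2 ![y 0, y 1, a]) 2) -
            ∫ y : EuclideanSpace ℝ (Fin 2), (‖u s (toLp 2 ![y 0, y 1, b])‖ ^ 2 / 2 +
                p s (toLp 2 ![y 0, y 1, b])) * u s (toLp 2 ![y 0, y 1, b]) 2‖ₑ := by
  have hU : UniqueDiffOn ℝ (Icc 0 t) := uniqueDiffOn_Icc ht
  have hsm := hcl.smooth_velocity
  -- the abstract assembly over `(0,s₁)`
  have hmain := ofReal_add_sink_le_of_integral_eq
    (I := fun τ => ∫ x, (-ν * (((x 2 - c₀) ^ 2 / (4 * (ν * (t - τ)) ^ 2) - 1 / (2 * (ν * (t - τ)))) *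
        heatKernel (ν * (t - τ)) (x 2 - c₀)) * ‖u τ x‖ ^ 2 +
        heatKernel (ν * (t - τ)) (x 2 - c₀) *
          (2 * ⟪ν • Δ (u τ) x - convect (u τ) (u τ) x - gradient (p τ) x, u τ x⟫)))
    (D := fun s => ∫ x, heatKernel (ν * (t - s)) (x 2 - c₀) *
        ∑ j : Fin 3, ‖fderiv ℝ (u s) x (EuclideanSpace.single j 1)‖ ^ 2)
    (B := fun s => 2 * (ENNReal.ofReal ((Real.sqrt (π * ν * (t - s)))⁻¹) *
        ⨆ (a : ℝ) (b : ℝ), ‖(∫ y : EuclideanSpace ℝ (Fin 2), (‖u s (toLp 2 ![y 0, y 1, a])‖ ^ 2 / 2 +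
              p s (toLp 2 ![y 0, y 1, a])) * u s (toLp 2 ![y 0, y 1, a]) 2) -
          ∫ y : EuclideanSpace ℝ (Fin 2), (‖u s (toLp 2 ![y 0, y 1, b])‖ ^ 2 / 2 +
              p s (toLp 2 ![y 0, y 1, b])) * u s (toLp 2 ![y 0, y 1, b]) 2‖ₑ))
    (Φ₁ := ∫ x, heatKernel (ν * (t - s₁)) (x 2 - c₀) * ‖u s₁ x‖ ^ 2)
    (Φ₀ := ∫ x, heatKernel (ν * t) (x 2 - c₀) * ‖u 0 x‖ ^ 2) (κ := 2 * ν) (s₁ := s₁)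
    (slabLaw_timeIntegration hν ht hcl h0 h1 h2 k1 c₀ hs₁ hs₁t)
    (integrableOn_sliceDensityIntegral hν ht hcl h0 h1 h2 k1 c₀ hs₁ hs₁t)
    (((continuousOn_caloricDissipation hν ht hsm h1 c₀ hs₁t).integrableOn_Icc).mono_set Ioo_subset_Icc_self)
    (fun s hs => integral_nonneg fun x => mul_nonneg (heatKernel_pos (mul_pos hν (by linarith [hs.2])) _).le
      (Finset.sum_nonneg fun j _ => sq_nonneg _))
    (integral_nonneg fun x => mul_nonneg (heatKernel_pos (mul_pos hν (by linarith)) _).le (sq_nonneg _))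
    (by positivity) ?hJ
  case hJ =>
    -- the slice identity at time `s`, for the normalised pressure `p − π₀(s)`
    intro s hs
    have hs' : s ∈ Icc 0 t := ⟨hs.1.le, (hs.2.trans hs₁t).le⟩
    have hσ : 0 < ν * (t - s) := mul_pos hν (by linarith [hs.2])
    have hu2 : ContDiff ℝ 2 (u s) := (hcl.contDiff_velocity hs').of_le (by norm_cast)
    have hu1 : ContDiff ℝ 1 (u s) := hu2.of_le one_le_two
    have hp1 : ContDiff ℝ 1 (fun x => p s x - π₀ s) :=
      ((hcl.contDiff_pressure hs').of_le (by exact_mod_cast le_top)).sub contDiff_const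
    have k0' : ∀ x, ‖p s x - π₀ s‖ ≤ C * (1 + ‖x‖) ^ (-(2 : ℝ)) := fun x => by
      rw [Real.norm_eq_abs]; exact k0 s hs' x
    have k1' : ∀ x, ‖fderiv ℝ (fun x => p s x - π₀ s) x‖ ≤ C * (1 + ‖x‖) ^ (-(2 : ℝ)) := fun x => by
      rw [fderiv_sub_const', norm_fderiv_eq_norm_gradient]; exact k1 s hs' x
    have hacc : Continuous fun x => ν • Δ (u s) x - convect (u s) (u s) x - gradient (fun x => p s x - π₀ s) x := by
      have hc : Continuous fun x => timeDerivWithin (Icc 0 t) u s x := by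
        have h1c : ContinuousOn (uncurry (timeDerivWithin (Icc 0 t) u)) (Icc 0 t ×ˢ univ) :=
          (hsm.timeDerivWithin hU).continuousOn
        exact h1c.comp_continuous (continuous_const.prodMk continuous_id) fun x => ⟨hs', mem_univ x⟩
      simp_rw [gradient_sub_const]
      exact hc.congr fun x => timeDerivWithin_eq_acc hcl hs' x
    have key := slabLaw_sliceIdentity hν.le hσ c₀ hu2 hp1 (hcl.divFree s hs') (h0 s hs') (h1 s hs') (h2 s hs')
      k0' k1' hacc
    simp only [gradient_sub_const] at key
    -- the flux term: subtract `F(0)` (`∫ G' = 0`) and drop the pressure constant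
    obtain ⟨K, -, hB1, -⟩ := heatKernel_shift_bounds hσ c₀
    have hcG' : Continuous fun z : ℝ => -((z - c₀) / (2 * (ν * (t - s)))) * heatKernel (ν * (t - s)) (z - c₀) := by
      have hcG : Continuous fun z : ℝ => heatKernel (ν * (t - s)) (z - c₀) :=
        (contDiff_heatKernel_shift (ν * (t - s)) c₀ (n := 0)).continuous
      fun_prop
    have hf : Integrable fun x => (‖u s x‖ ^ 2 / 2 + (p s x - π₀ s)) * u s x 2 :=
      integrable_bernoulli_mul' hu1 hp1 (h0 s hs') k0' 2
    have hsub := integral_kernelDeriv_mul_bernoulli_eq hσ c₀ 0 hu1 hp1 (h0 s hs') k0'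
    rw [integral_weight_mul_eq_integral_mul_integral_plane hf hcG' hB1] at hsub
    have hflux : ∀ a, ∫ y : EuclideanSpace ℝ (Fin 2), (‖u s (toLp 2 ![y 0, y 1, a])‖ ^ 2 / 2 +
        (p s (toLp 2 ![y 0, y 1, a]) - π₀ s)) * u s (toLp 2 ![y 0, y 1, a]) 2 =
        ∫ y : EuclideanSpace ℝ (Fin 2), (‖u s (toLp 2 ![y 0, y 1, a])‖ ^ 2 / 2 +
          p s (toLp 2 ![y 0, y 1, a])) * u s (toLp 2 ![y 0, y 1, a]) 2 := fun a =>
      planarBernoulliFlux_sub_const hu1 (hcl.contDiff_pressure hs').continuous (hcl.divFree s hs')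
        (h0 s hs') (h1 s hs') (π₀ s) k0' a
    have hosc := ofReal_two_mul_integral_kernelDeriv_mul_sub_le hσ c₀ 0
      (fun c => ∫ y : EuclideanSpace ℝ (Fin 2), (‖u s (toLp 2 ![y 0, y 1, c])‖ ^ 2 / 2 +
        (p s (toLp 2 ![y 0, y 1, c]) - π₀ s)) * u s (toLp 2 ![y 0, y 1, c]) 2)
    dsimp only
    rw [key]
    simp_rw [hflux] at hosc hsub ⊢
    rw [hsub, show π * ν * (t - s) = π * (ν * (t - s)) by ring]
    refine le_of_eq_of_le ?_ hosc
    congr 1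
    ring
  -- the initial caloric mean and the time integral over `(0,t)`
  refine hmain.trans (add_le_add ?_ ?_)
  · have hI0 : Integrable fun x => ‖u 0 x‖ ^ 2 :=
      integrable_norm_sq (hcl.contDiff_velocity ⟨le_rfl, ht.le⟩).continuous (h0 0 ⟨le_rfl, ht.le⟩)
    obtain ⟨K, hB0, -, -⟩ := heatKernel_shift_bounds (mul_pos hν ht) c₀
    rw [integral_weight_mul_eq_integral_mul_integral_plane hI0 (contDiff_heatKernel_shift (ν * t) c₀ (n := 0)).continuous hB0]
    refine (ofReal_integral_heatKernel_mul_le_iSup (mul_pos hν ht) c₀ _).trans ?_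
    refine iSup_mono fun c' => le_of_eq ?_
    rw [lintegral_enorm_sq_eq_ofReal]
    exact integrable_plane_of_norm_le_rpow (g := fun x => ‖u 0 x‖ ^ 2)
      ((hcl.contDiff_velocity ⟨le_rfl, ht.le⟩).continuous.norm.pow 2) (by norm_num : (2 : ℝ) < 6)
      (fun x => by rw [Real.norm_of_nonneg (sq_nonneg _)]; exact norm_sq_le_weight (h0 0 ⟨le_rfl, ht.le⟩ x)) c'
  · refine (lintegral_mono_set (Ioo_subset_Ioo_right hs₁t.le)).trans (le_of_eq ?_)
    rw [lintegral_const_mul' _ _ ENNReal.ofNat_ne_top]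

end Coord

section Limit

variable {ν t : ℝ} {u : ℝ → EuclideanSpace ℝ (Fin 3) → EuclideanSpace ℝ (Fin 3)} {p : ℝ → EuclideanSpace ℝ (Fin 3) → ℝ}

/-- **THE MILD SLAB LAW WITH THE SINK, COORDINATE PLANES** (`ν, t > 0`, order-(3,2) decay):
`E(t,c₀) + ofReal(2ν)·∫⁻_{(0,t)} ofReal(∫ G_{ν(t−s)}(x₂−c₀) Σⱼ‖∂ⱼu(s)‖² dx) ds
 ≤ sup_{c'} E(0,c') + 2∫⁻_{(0,t)} ofReal((√(πν(t−s)))⁻¹) · sup_{a,b} ‖F(s,a) − F(s,b)‖ₑ ds`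
(limit `s₁ ↑ t` of `slabLawSink_coord_of_lt` along `t − t/(n+2)`; sink by monotone convergence). [folklore] -/
theorem slabLawSink_coord (hν : 0 < ν) (ht : 0 < t) (hcl : IsClassicalNSSolutionOn (Icc 0 t) ν 0 u p)
    {C : ℝ} {π₀ : ℝ → ℝ}
    (h0 : ∀ s ∈ Icc 0 t, ∀ x, ‖u s x‖ ≤ C * (1 + ‖x‖) ^ (-(3 : ℝ)))
    (h1 : ∀ s ∈ Icc 0 t, ∀ x, ‖fderiv ℝ (u s) x‖ ≤ C * (1 + ‖x‖) ^ (-(3 : ℝ)))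
    (h2 : ∀ s ∈ Icc 0 t, ∀ x, ‖iteratedFDeriv ℝ 2 (u s) x‖ ≤ C * (1 + ‖x‖) ^ (-(3 : ℝ)))
    (k0 : ∀ s ∈ Icc 0 t, ∀ x, |p s x - π₀ s| ≤ C * (1 + ‖x‖) ^ (-(2 : ℝ)))
    (k1 : ∀ s ∈ Icc 0 t, ∀ x, ‖gradient (p s) x‖ ≤ C * (1 + ‖x‖) ^ (-(2 : ℝ))) (c₀ : ℝ) :
    (∫⁻ y : EuclideanSpace ℝ (Fin 2), ‖u t (toLp 2 ![y 0, y 1, c₀])‖ₑ ^ 2) +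
      ENNReal.ofReal (2 * ν) * ∫⁻ s in Ioo 0 t, ENNReal.ofReal (∫ x, heatKernel (ν * (t - s)) (x 2 - c₀) *
        ∑ j : Fin 3, ‖fderiv ℝ (u s) x (EuclideanSpace.single j 1)‖ ^ 2) ≤
      (⨆ c' : ℝ, ∫⁻ y : EuclideanSpace ℝ (Fin 2), ‖u 0 (toLp 2 ![y 0, y 1, c'])‖ₑ ^ 2) +
        2 * ∫⁻ s in Ioo 0 t, ENNReal.ofReal ((Real.sqrt (π * ν * (t - s)))⁻¹) *
          ⨆ (a : ℝ) (b : ℝ), ‖(∫ y : EuclideanSpace ℝ (Fin 2), (‖u s (toLp 2 ![y 0, y 1, a])‖ ^ 2 / 2 +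
                p s (toLp 2 ![y 0, y 1, a])) * u s (toLp 2 ![y 0, y 1, a]) 2) -
            ∫ y : EuclideanSpace ℝ (Fin 2), (‖u s (toLp 2 ![y 0, y 1, b])‖ ^ 2 / 2 +
                p s (toLp 2 ![y 0, y 1, b])) * u s (toLp 2 ![y 0, y 1, b]) 2‖ₑ := by
  have htt : t ∈ Icc 0 t := ⟨ht.le, le_rfl⟩
  -- the times `s_n = t − t/(n+2) ↑ t`
  set sq : ℕ → ℝ := fun n => t - t / ((n + 2 : ℕ) : ℝ) with hsq
  have hpos : ∀ n : ℕ, (0 : ℝ) < ((n + 2 : ℕ) : ℝ) := fun n => by positivity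
  have hsq_mem : ∀ n, sq n ∈ Ioo 0 t := fun n => by
    have h2 : (2 : ℝ) ≤ ((n + 2 : ℕ) : ℝ) := by exact_mod_cast Nat.le_add_left 2 n
    have hlt : t / ((n + 2 : ℕ) : ℝ) < t := by
      rw [div_lt_iff₀ (hpos n)]; nlinarith
    have hgt : 0 < t / ((n + 2 : ℕ) : ℝ) := div_pos ht (hpos n)
    constructor <;> simp only [hsq] <;> linarith
  have hsq_mono : Monotone sq := fun m n hmn => by
    simp only [hsq]
    have : t / ((n + 2 : ℕ) : ℝ) ≤ t / ((m + 2 : ℕ) : ℝ) :=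
      div_le_div_of_nonneg_left ht.le (hpos m) (by exact_mod_cast Nat.add_le_add_right hmn 2)
    linarith
  have hsq_tend : Tendsto sq atTop (𝓝[<] t) := by
    refine tendsto_nhdsWithin_iff.2 ⟨?_, Eventually.of_forall fun n => (hsq_mem n).2⟩
    have h1 : Tendsto (fun n : ℕ => t / ((n + 2 : ℕ) : ℝ)) atTop (𝓝 0) :=
      (tendsto_const_div_atTop_nhds_zero_nat t).comp (tendsto_add_atTop_nat 2)
    simpa [hsq] using tendsto_const_nhds.sub h1
  have hU : (⋃ n, Ioo 0 (sq n)) = Ioo 0 t := by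
    refine Subset.antisymm (iUnion_subset fun n => Ioo_subset_Ioo_right (hsq_mem n).2.le) fun x hx => ?_
    have htx : 0 < t - x := by linarith [hx.2]
    obtain ⟨n, hn⟩ := exists_nat_gt (t / (t - x))
    refine mem_iUnion.2 ⟨n, hx.1, ?_⟩
    simp only [hsq]
    have hcast : (n : ℝ) ≤ ((n + 2 : ℕ) : ℝ) := by exact_mod_cast Nat.le_add_right n 2
    have hlt : t / ((n + 2 : ℕ) : ℝ) < t - x := by
      rw [div_lt_iff₀ (hpos n)]
      have := (div_lt_iff₀ htx).1 hn
      nlinarith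
    linarith
  have hmonoI : Monotone fun n => Ioo 0 (sq n) := fun m n h => Ioo_subset_Ioo_right (hsq_mono h)
  have hdir : Directed (· ⊆ ·) fun n => Ioo 0 (sq n) := hmonoI.directed_le
  -- the sink: monotone convergence over `(0, s_n) ↑ (0,t)`
  have hb : Tendsto (fun n => ENNReal.ofReal (2 * ν) * ∫⁻ s in Ioo 0 (sq n), ENNReal.ofReal (∫ x,
      heatKernel (ν * (t - s)) (x 2 - c₀) * ∑ j : Fin 3, ‖fderiv ℝ (u s) x (EuclideanSpace.single j 1)‖ ^ 2)) atTop
      (𝓝 (ENNReal.ofReal (2 * ν) * ∫⁻ s in Ioo 0 t, ENNReal.ofReal (∫ x,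
        heatKernel (ν * (t - s)) (x 2 - c₀) * ∑ j : Fin 3, ‖fderiv ℝ (u s) x (EuclideanSpace.single j 1)‖ ^ 2))) := by
    refine ENNReal.Tendsto.const_mul ?_ (Or.inr ENNReal.ofReal_ne_top)
    rw [← hU, setLIntegral_iUnion_of_directed _ hdir]
    exact tendsto_atTop_iSup fun m n h => lintegral_mono_set (Ioo_subset_Ioo_right (hsq_mono h))
  -- the energy: the caloric means converge to `E(t,c₀)`
  have hlim := tendsto_integral_planarEnergy_mul_heatKernel hν ht hcl h0 h1 h2 k1 c₀
  have hEt : ∫⁻ y : EuclideanSpace ℝ (Fin 2), ‖u t (toLp 2 ![y 0, y 1, c₀])‖ₑ ^ 2 =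
      ENNReal.ofReal (∫ y : EuclideanSpace ℝ (Fin 2), ‖u t (toLp 2 ![y 0, y 1, c₀])‖ ^ 2) :=
    lintegral_enorm_sq_eq_ofReal (integrable_plane_of_norm_le_rpow (g := fun x => ‖u t x‖ ^ 2)
      ((hcl.contDiff_velocity htt).continuous.norm.pow 2) (by norm_num : (2 : ℝ) < 6)
      (fun x => by rw [Real.norm_of_nonneg (sq_nonneg _)]; exact norm_sq_le_weight (h0 t htt x)) c₀)
  have hΦ : ∀ s ∈ Ioo 0 t, ∫ c : ℝ, (∫ y : EuclideanSpace ℝ (Fin 2), ‖u s (toLp 2 ![y 0, y 1, c])‖ ^ 2) *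
      heatKernel (ν * (t - s)) (c - c₀) = ∫ x, heatKernel (ν * (t - s)) (x 2 - c₀) * ‖u s x‖ ^ 2 := by
    intro s hs
    have hs' : s ∈ Icc 0 t := ⟨hs.1.le, hs.2.le⟩
    have hIs : Integrable fun x => ‖u s x‖ ^ 2 := integrable_norm_sq (hcl.contDiff_velocity hs').continuous (h0 s hs')
    obtain ⟨K, hB0, -, -⟩ := heatKernel_shift_bounds (mul_pos hν (by linarith [hs.2] : (0 : ℝ) < t - s)) c₀
    rw [integral_weight_mul_eq_integral_mul_integral_plane hIs
      (contDiff_heatKernel_shift (ν * (t - s)) c₀ (n := 0)).continuous hB0]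
    exact integral_congr_ae (ae_of_all _ fun c => mul_comm _ _)
  have ha : Tendsto (fun n => ENNReal.ofReal (∫ x, heatKernel (ν * (t - sq n)) (x 2 - c₀) * ‖u (sq n) x‖ ^ 2)) atTop
      (𝓝 (∫⁻ y : EuclideanSpace ℝ (Fin 2), ‖u t (toLp 2 ![y 0, y 1, c₀])‖ₑ ^ 2)) := by
    rw [hEt]
    refine (((ENNReal.continuous_ofReal.tendsto _).comp hlim).comp hsq_tend).congr fun n => ?_
    simp only [Function.comp_def]
    rw [hΦ _ (hsq_mem n)]
  -- pass to the limit in the pre-limit law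
  exact le_of_tendsto' (ha.add hb) fun n =>
    slabLawSink_coord_of_lt hν ht hcl h0 h1 h2 k0 k1 c₀ (hsq_mem n).1 (hsq_mem n).2

end Limit

/-! ### Every direction -/

section Dir

variable {ν t : ℝ} {u : ℝ → EuclideanSpace ℝ (Fin 3) → EuclideanSpace ℝ (Fin 3)} {p : ℝ → EuclideanSpace ℝ (Fin 3) → ℝ}

/-- **THE MILD SLAB LAW WITH THE SINK THROUGH EVERY PLANE.** Classical solution on `[0,t]`
(`ν, t > 0`) with order-(3,2) decay (pressure constant `π₀(s)`); for every linear isometry `R`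
(unit normal `n = Re₂`) and offset `c`:
`E(t;R,c) + ofReal(2ν)·∫⁻_{(0,t)} ofReal(∫ G_{ν(t−s)}(⟪x,n⟫ − c) Σⱼ‖∂ⱼu(s,x)‖² dx) ds
 ≤ sup_{c'} E(0;R,c') + 2∫⁻_{(0,t)} ofReal((√(πν(t−s)))⁻¹) · sup_{a,b} ‖F(s;R,a) − F(s;R,b)‖ₑ ds`,
`F(s;R,a) = ∫_{R{x₂=a}} (|u|²/2 + p)⟪u, n⟫` (rotation covariance). [folklore] -/
theorem slabLawSink_dir (hν : 0 < ν) (ht : 0 < t) (hcl : IsClassicalNSSolutionOn (Icc 0 t) ν 0 u p)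
    {C : ℝ} {π₀ : ℝ → ℝ}
    (h0 : ∀ s ∈ Icc 0 t, ∀ x, ‖u s x‖ ≤ C * (1 + ‖x‖) ^ (-(3 : ℝ)))
    (h1 : ∀ s ∈ Icc 0 t, ∀ x, ‖fderiv ℝ (u s) x‖ ≤ C * (1 + ‖x‖) ^ (-(3 : ℝ)))
    (h2 : ∀ s ∈ Icc 0 t, ∀ x, ‖iteratedFDeriv ℝ 2 (u s) x‖ ≤ C * (1 + ‖x‖) ^ (-(3 : ℝ)))
    (k0 : ∀ s ∈ Icc 0 t, ∀ x, |p s x - π₀ s| ≤ C * (1 + ‖x‖) ^ (-(2 : ℝ)))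
    (k1 : ∀ s ∈ Icc 0 t, ∀ x, ‖gradient (p s) x‖ ≤ C * (1 + ‖x‖) ^ (-(2 : ℝ)))
    (R : EuclideanSpace ℝ (Fin 3) ≃ₗᵢ[ℝ] EuclideanSpace ℝ (Fin 3)) (c : ℝ) :
    (∫⁻ y : EuclideanSpace ℝ (Fin 2), ‖u t (R (toLp 2 ![y 0, y 1, c]))‖ₑ ^ 2) +
      ENNReal.ofReal (2 * ν) * ∫⁻ s in Ioo 0 t, ENNReal.ofReal (∫ x,
        heatKernel (ν * (t - s)) (⟪x, R (EuclideanSpace.single 2 1)⟫ - c) *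
          ∑ j : Fin 3, ‖fderiv ℝ (u s) x (EuclideanSpace.single j 1)‖ ^ 2) ≤
      (⨆ c' : ℝ, ∫⁻ y : EuclideanSpace ℝ (Fin 2), ‖u 0 (R (toLp 2 ![y 0, y 1, c']))‖ₑ ^ 2) +
        2 * ∫⁻ s in Ioo 0 t, ENNReal.ofReal ((Real.sqrt (π * ν * (t - s)))⁻¹) *
          ⨆ (a : ℝ) (b : ℝ), ‖(∫ y : EuclideanSpace ℝ (Fin 2), (‖u s (R (toLp 2 ![y 0, y 1, a]))‖ ^ 2 / 2 +
                p s (R (toLp 2 ![y 0, y 1, a]))) * ⟪u s (R (toLp 2 ![y 0, y 1, a])), R (EuclideanSpace.single 2 1)⟫) -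
            ∫ y : EuclideanSpace ℝ (Fin 2), (‖u s (R (toLp 2 ![y 0, y 1, b]))‖ ^ 2 / 2 +
                p s (R (toLp 2 ![y 0, y 1, b]))) * ⟪u s (R (toLp 2 ![y 0, y 1, b])), R (EuclideanSpace.single 2 1)⟫‖ₑ := by
  have hU : UniqueDiffOn ℝ (Icc 0 t) := uniqueDiffOn_Icc ht
  -- the conjugate pair
  set v : ℝ → EuclideanSpace ℝ (Fin 3) → EuclideanSpace ℝ (Fin 3) := fun s x => R.symm (u s (R.symm.symm x)) with hv
  set q : ℝ → EuclideanSpace ℝ (Fin 3) → ℝ := fun s x => p s (R.symm.symm x) with hq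
  have hvu : ∀ s x, v s x = R.symm (u s (R x)) := fun s x => by simp [hv]
  have hqp : ∀ s x, q s x = p s (R x) := fun s x => by simp [hq]
  have hcl' : IsClassicalNSSolutionOn (Icc 0 t) ν 0 v q := by
    have h := hcl.conj_linearIsometryEquiv (R := R.symm) hU
    refine h.congr_force fun s _ x => ?_
    simp
  -- decay of the conjugate pair
  have h0' : ∀ s ∈ Icc 0 t, ∀ x, ‖v s x‖ ≤ C * (1 + ‖x‖) ^ (-(3 : ℝ)) := fun s hs' x => by
    rw [hvu, LinearIsometryEquiv.norm_map]; simpa [LinearIsometryEquiv.norm_map] using h0 s hs' (R x)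
  have h1' : ∀ s ∈ Icc 0 t, ∀ x, ‖fderiv ℝ (v s) x‖ ≤ C * (1 + ‖x‖) ^ (-(3 : ℝ)) := fun s hs' x => by
    have : v s = fun y => R.symm (u s (R.symm.symm y)) := rfl
    rw [this, fderiv_conj_linearIsometryEquiv, ContinuousLinearMap.opNorm_linearIsometryEquiv_comp,
      ContinuousLinearMap.opNorm_comp_linearIsometryEquiv]
    simpa [LinearIsometryEquiv.norm_map] using h1 s hs' (R x)
  have h2' : ∀ s ∈ Icc 0 t, ∀ x, ‖iteratedFDeriv ℝ 2 (v s) x‖ ≤ C * (1 + ‖x‖) ^ (-(3 : ℝ)) := fun s hs' x => by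
    have : v s = R.symm ∘ (u s ∘ R.symm.symm) := rfl
    rw [this, LinearIsometryEquiv.norm_iteratedFDeriv_comp_left, LinearIsometryEquiv.norm_iteratedFDeriv_comp_right]
    simpa [LinearIsometryEquiv.norm_map] using h2 s hs' (R x)
  have k0' : ∀ s ∈ Icc 0 t, ∀ x, |q s x - π₀ s| ≤ C * (1 + ‖x‖) ^ (-(2 : ℝ)) := fun s hs' x => by
    rw [hqp]; simpa [LinearIsometryEquiv.norm_map] using k0 s hs' (R x)
  have k1' : ∀ s ∈ Icc 0 t, ∀ x, ‖gradient (q s) x‖ ≤ C * (1 + ‖x‖) ^ (-(2 : ℝ)) := fun s hs' x => by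
    have : q s = fun y => p s (R.symm.symm y) := rfl
    rw [this, gradient_comp_linearIsometryEquiv_symm, LinearIsometryEquiv.norm_map]
    simpa [LinearIsometryEquiv.norm_map] using k1 s hs' (R x)
  -- the coordinate law for the conjugate pair
  have key := slabLawSink_coord hν ht hcl' h0' h1' h2' k0' k1' c
  -- planar energies, fluxes and the caloric dissipation of `(v,q)` are those of `(u,p)` through `R{x₂ = ·}`
  have hv2 : ∀ s x, v s x 2 = ⟪u s (R x), R (EuclideanSpace.single 2 1)⟫ := fun s x => by
    rw [hvu]
    have : (R.symm (u s (R x))) 2 = ⟪R.symm (u s (R x)), EuclideanSpace.single 2 1⟫ := by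
      simp [EuclideanSpace.inner_single_right]
    rw [this]
    conv_lhs => rw [← LinearIsometryEquiv.inner_map_map R, LinearIsometryEquiv.apply_symm_apply]
  have hE : ∀ s a, ∫⁻ y : EuclideanSpace ℝ (Fin 2), ‖v s (toLp 2 ![y 0, y 1, a])‖ₑ ^ 2 =
      ∫⁻ y : EuclideanSpace ℝ (Fin 2), ‖u s (R (toLp 2 ![y 0, y 1, a]))‖ₑ ^ 2 := fun s a =>
    lintegral_congr fun y => by rw [hvu, LinearIsometryEquiv.enorm_map]
  have hF : ∀ s a, ∫ y : EuclideanSpace ℝ (Fin 2), (‖v s (toLp 2 ![y 0, y 1, a])‖ ^ 2 / 2 +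
      q s (toLp 2 ![y 0, y 1, a])) * v s (toLp 2 ![y 0, y 1, a]) 2 =
      ∫ y : EuclideanSpace ℝ (Fin 2), (‖u s (R (toLp 2 ![y 0, y 1, a]))‖ ^ 2 / 2 +
        p s (R (toLp 2 ![y 0, y 1, a]))) * ⟪u s (R (toLp 2 ![y 0, y 1, a])), R (EuclideanSpace.single 2 1)⟫ :=
    fun s a => integral_congr_ae (ae_of_all _ fun y => by
      dsimp only
      rw [hv2, hqp, hvu, LinearIsometryEquiv.norm_map])
  have hS : ∀ s, ∫ x, heatKernel (ν * (t - s)) (x 2 - c) * ∑ j : Fin 3, ‖fderiv ℝ (v s) x (EuclideanSpace.single j 1)‖ ^ 2 =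
      ∫ x, heatKernel (ν * (t - s)) (⟪x, R (EuclideanSpace.single 2 1)⟫ - c) *
        ∑ j : Fin 3, ‖fderiv ℝ (u s) x (EuclideanSpace.single j 1)‖ ^ 2 := by
    intro s
    have hpt : ∀ x, ∑ j : Fin 3, ‖fderiv ℝ (v s) x (EuclideanSpace.single j 1)‖ ^ 2 =
        ∑ j : Fin 3, ‖fderiv ℝ (u s) (R x) (EuclideanSpace.single j 1)‖ ^ 2 := by
      intro x
      have hvs : v s = fun y => R.symm (u s (R.symm.symm y)) := rfl
      have hfd := fderiv_conj_linearIsometryEquiv (R := R.symm) (u s) x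
      rw [← hvs] at hfd
      have hj : ∀ j : Fin 3, ‖fderiv ℝ (v s) x (EuclideanSpace.single j 1)‖ =
          ‖fderiv ℝ (u s) (R x) (R (EuclideanSpace.single j 1))‖ := fun j => by
        rw [hfd]; simp
      simp_rw [hj]
      exact sum_norm_sq_apply_isometry_single (fderiv ℝ (u s) (R x)) R
    have hx2 : ∀ x : EuclideanSpace ℝ (Fin 3), x 2 = ⟪R x, R (EuclideanSpace.single 2 1)⟫ := fun x => by
      rw [LinearIsometryEquiv.inner_map_map]; simp [EuclideanSpace.inner_single_right]
    simp_rw [hpt, hx2]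
    exact integral_comp_isometry R (fun x => heatKernel (ν * (t - s)) (⟪x, R (EuclideanSpace.single 2 1)⟫ - c) *
      ∑ j : Fin 3, ‖fderiv ℝ (u s) x (EuclideanSpace.single j 1)‖ ^ 2)
  simp_rw [hE, hF, hS] at key
  exact key

end Dir

/-- **The mild slab law with the sink, registered closed form** (sub-goal `slabLawMildWithSink`
of stmt-NavierStokesRegularity-16855): the statement of the landed stub `stub_slabLawMild`
(verbatim hypotheses and right-hand side) with the caloric dissipation
`ofReal(2ν)·∫⁻_{(0,t)} ofReal(∫ G_{ν(t−s)}(⟪x,Re₂⟫ − c) Σⱼ‖∂ⱼu(s,x)‖² dx) ds` ADDED on the left.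
[folklore] -/
theorem slabLawMildWithSink : ∀ (ν t : ℝ), 0 < ν → 0 < t → ∀ (u : ℝ → EuclideanSpace ℝ (Fin 3) → EuclideanSpace ℝ (Fin 3)) (p : ℝ → EuclideanSpace ℝ (Fin 3) → ℝ), Literature.Analysis.FluidPDE.IsClassicalNSSolutionOn (Set.Icc 0 t) ν 0 u p → (∃ (C₀ : ℝ) (π₀ : ℝ → ℝ), ∀ s ∈ Set.Icc 0 t, ∀ x : EuclideanSpace ℝ (Fin 3), (1 + ‖x‖) ^ 3 * ‖u s x‖ ≤ C₀ ∧ (1 + ‖x‖) ^ 3 * ‖fderiv ℝ (u s) x‖ ≤ C₀ ∧ (1 + ‖x‖) ^ 3 * ‖iteratedFDeriv ℝ 2 (u s) x‖ ≤ C₀ ∧ (1 + ‖x‖) ^ 2 * |p s x - π₀ s| ≤ C₀ ∧ (1 + ‖x‖) ^ 2 * ‖gradient (p s) x‖ ≤ C₀) → ∀ (R : EuclideanSpace ℝ (Fin 3) ≃ₗᵢ[ℝ] EuclideanSpace ℝ (Fin 3)) (c : ℝ), (∫⁻ y : EuclideanSpace ℝ (Fin 2), ‖u t (R (WithLp.toLp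 2 ![y 0, y 1, c]))‖ₑ ^ 2) + ENNReal.ofReal (2 * ν) * (∫⁻ s in Set.Ioo 0 t, ENNReal.ofReal (∫ x, Literature.Analysis.UnboundedOperators.heatKernel (ν * (t - s)) (inner ℝ x (R (EuclideanSpace.single 2 1)) - c) * ∑ j : Fin 3, ‖fderiv ℝ (u s) x (EuclideanSpace.single j 1)‖ ^ 2)) ≤ (⨆ c' : ℝ, ∫⁻ y : EuclideanSpace ℝ (Fin 2), ‖u 0 (R (WithLp.toLp 2 ![y 0, y 1, c']))‖ₑ ^ 2) + 2 * (∫⁻ s in Set.Ioo 0 t, ENNReal.ofReal ((Real.sqrt (Real.pi * ν * (t - s)))⁻¹) * (⨆ (a : ℝ) (b : ℝ), ‖(∫ y : EuclideanSpace ℝ (Fin 2), (‖u s (R (WithLp.toLp 2 ![y 0, y 1, a]))‖ ^ 2 / 2 + p s (R (WithLp.toLp 2 ![y 0, y 1, a]))) * inner ℝ (u s (R (WithLp.toLp 2 ![y 0, y 1, a]))) (R (EuclideanSpace.single 2 1))) - (∫ y : EuclideanSpace ℝ (Fin 2), (‖u s (R (WithLp.toLp 2 ![y 0, y 1, b]))‖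 ^ 2 / 2 + p s (R (WithLp.toLp 2 ![y 0, y 1, b]))) * inner ℝ (u s (R (WithLp.toLp 2 ![y 0, y 1, b]))) (R (EuclideanSpace.single 2 1)))‖ₑ)) :=
  fun _ _ hν ht _ _ hcl hdec R c => by
    obtain ⟨C₀, π₀, hdec⟩ := hdec
    exact slabLawSink_dir hν ht hcl
      (fun s hs x => le_mul_rpow_neg_three_of_mul_le (hdec s hs x).1)
      (fun s hs x => le_mul_rpow_neg_three_of_mul_le (hdec s hs x).2.1)
      (fun s hs x => le_mul_rpow_neg_three_of_mul_le (hdec s hs x).2.2.1)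
      (fun s hs x => le_mul_rpow_neg_two_of_mul_le (hdec s hs x).2.2.2.1)
      (fun s hs x => le_mul_rpow_neg_two_of_mul_le (hdec s hs x).2.2.2.2) R c

end Summit.NavierStokesRegularity.NavierStokesRegularity.Theorems.PlanarEnergyAPriori

end
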